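import Mathlib.LinearAlgebra.Matrix.Trace
import Mathlib.LinearAlgebra.Dimension.Constructions
import Literature.Barriers.ValiantsHypothesis.UnpaddedShiftedPartialsIMM
import Literature.Barriers.ValiantsHypothesis.UnpaddedShiftedPartialsQuadric
import Literature.Barriers.ValiantsHypothesis.ShiftedPartialsPermanentSide
import HarnessLib

/-!
# Case 3 of the printed proof of Gesmundo–Landsberg's Theorem 2: the power-sum degeneration has
too few shifted partials (why the printed argument does not cover `e < ⌈m/2⌉, τ > m³`)

Gesmundo–Landsberg (Theory of Computing 15 (2019), art. 3 = arXiv:1705.03866), §4, Case 3 of the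
proof of Thm. 2 (`s < m/2`, `τ > m³`): "Here set all matrices `(X_1, …, X_m)` equal to a matrix that
is zero except for the first `m²` entries on the diagonal, call them `y_1, …, y_{m²}`. The resulting
degeneration of `IMM^m_n` is `y_1^m + ⋯ + y_{m²}^m`. As in Case 1, it will suffice to prove the result
for the shifted partials of both polynomials in `m²` variables because the remaining `mn² - m²`
variables will contribute the same growth to both ideals. The space of partial derivatives of order
`s` is `⟨y_1^{m-s}, …, y_{m²}^{m-s}⟩`. The image of the `τ`-th shifted partial map consists of all
polynomials in `m²` variables of degree `m-s+τ` as soon as `m-s+τ > m²(m-s-1)+1` ..."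

This file makes precise why this does not prove the claimed inequality
`dim⟨∂^{=s} perm_m⟩_τ ≤ dim⟨∂^{=s} IMM^m_n⟩_τ` in the `N = mn²` variables through that
degeneration `P`: monotonicity (`rank IMM ≥ rank P`, ELSW §1.1) would need `rank P ≥ rank perm_m`
in the `N` variables, and

* `exists_endOrbit_immPoly_eq_powerSum`: the printed degeneration, `P = Σ_{i ∈ S} x⁽⁰⁾ᵢᵢ^m` for a
  set `S` of diagonal positions, is indeed in `End · IMM^m_n`;
* `shiftedPartialsRank_powerSum_le`: every order-`s` derivative of a sum of `r` `d`-th powers of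
  variables is a combination of the `r` powers `y_i^{d-s}`, so (no syzygies needed)
  `rank(P_{(s,·)[τ]}) ≤ r · binom(N+τ-1, τ)`;
* `card_mul_shiftedPartialsRank_zero_le`: for ANY polynomial `p` in the variables `Z`, multiplying its
  order-`s` derivatives by the monomials of degree `τ` in the variables OUTSIDE `Z` gives independent
  directions: `#Mon_τ(Zᶜ) · rank(p_{s,·}) ≤ rank(p_{(s,·)[τ]})`; with `rank((perm_m)_{s,m-s}) =
  binom(m,s)²` (tree: `flatteningRank_perPoly`, transported along the relabelling by
  `le_shiftedPartialsRank_zero_rename`) this is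
  `binom(m,s)² · binom(N-m²+τ-1, τ) ≤ rank((perm_m)_{(s,·)[τ]})`;
* `powerSum_lt_perm_of_lt`: hence whenever `m² binom(N+τ-1,τ) < binom(m,s)² binom(N-m²+τ-1,τ)` —
  which, as `binom(N+τ-1,τ)/binom(N-m²+τ-1,τ) ≤ (1+τ/(N-m²))^{m²}`, holds for all `2 ≤ s ≤ m-2` and
  `τ < (N-m²)·ln(binom(m,s)²/m²)/m²`, in particular throughout `m³ < τ ≤ N/m²` once `m ≥ 5`
  (e.g. `m = 6`, `s = 2`, `n = 7777`: all `τ ≤ 10⁷`) — the power sum has STRICTLY FEWER shifted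
  partials than the permanent, so the printed Case 3 cannot be completed through it; the sentence
  "the remaining variables will contribute the same growth to both ideals" hides that padding mixes
  all shifts `≤ τ`, `dim⟨∂^s p⟩^V_τ = Σ_{j ≤ τ} dim⟨∂^s p⟩^{V₁}_j · #Mon_{τ-j}(V ∖ V₁)`, while the
  comparison in `m²` variables is printed for shifts `> m³` only.

Nothing here refutes Theorem 2 itself (plausibly true); it documents that its printed proof is
incomplete in the range `e < ⌈m/2⌉, τ > m³` (the complementary range is proved in
`UnpaddedShiftedPartialsProofs.lean`).

## References

* [GesmundoLandsberg2017] F. Gesmundo, J. M. Landsberg, Theory Comput. 15 (2019), art. 3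
  (arXiv:1705.03866), §4 (proof of Thm. 2, Case 3).
* [EfremenkoLandsbergSchenckWeyman2018] K. Efremenko, J. M. Landsberg, H. Schenck, J. Weyman, Math.
  Comp. 87 (2018), §1.1.
-/

noncomputable section

namespace Literature.Barriers.ValiantsHypothesis

open MvPolynomial Literature.Computability.AlgebraicComplexity

/-! ### The printed degeneration of Case 3 -/

section Degeneration

variable {K : Type*} [CommRing K] {m n : ℕ} [NeZero m]

/-- **GL §4, Case 3, the degeneration**: setting every matrix `X_t` to the same diagonal matrix with
the variables `x⁽⁰⁾ᵢᵢ`, `i ∈ S`, on the diagonal (and `0` elsewhere) degenerates `IMM^m_n` to the power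
sum `Σ_{i ∈ S} (x⁽⁰⁾ᵢᵢ)^m` ("The resulting degeneration of `IMM^m_n` is `y_1^m + ⋯ + y_{m²}^m`", there
with `#S = m²`). [cite: GesmundoLandsberg2017, §4 (Case 3)] -/
theorem exists_endOrbit_immPoly_eq_powerSum (S : Finset (Fin n)) :
    ∃ G ∈ endOrbit (Fin m × Fin n × Fin n) K (immPoly n m K),
      G = ∑ i ∈ S, X (((0 : Fin m), i, i) : Fin m × Fin n × Fin n) ^ m := by
  classical
  let d : Fin m × Fin n × Fin n → Option (Fin m × Fin n × Fin n) :=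
    fun v => if v.2.1 = v.2.2 ∧ v.2.1 ∈ S then some (0, v.2.1, v.2.1) else none
  refine ⟨_, aeval_option_mem_endOrbit d (immPoly n m K), ?_⟩
  rw [aeval_immPoly]
  set D : Fin n → MvPolynomial (Fin m × Fin n × Fin n) K :=
    fun i => if i ∈ S then X (((0 : Fin m), i, i) : Fin m × Fin n × Fin n) else 0 with hD
  have hmat : (fun t : Fin m => Matrix.of fun i j => ((d (t, i, j)).elim (0 : MvPolynomial _ K) X)) =
      fun _ => Matrix.diagonal D := by
    funext t
    ext i j
    simp only [Matrix.of_apply, Matrix.diagonal_apply, d, hD]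
    by_cases hij : i = j
    · subst hij
      by_cases hi : i ∈ S <;> simp [hi]
    · simp [hij]
  rw [hmat, List.map_const', List.length_finRange, List.prod_replicate, Matrix.diagonal_pow,
    Matrix.trace_diagonal]
  refine (Finset.sum_subset (Finset.subset_univ S) fun i _ hi => ?_).symm.trans
    (Finset.sum_congr rfl fun i hi => ?_)
  · simp [hD, hi, NeZero.ne m]
  · simp [hD, hi]

end Degeneration

/-! ### Upper bound for power sums -/

section PowerSum

variable {K : Type*} [Field K] {σ : Type*}

/-- Iterated derivatives of a power of a variable are scalar multiples of the complementary power.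
[folklore] -/
theorem exists_iterPDeriv_X_pow [DecidableEq σ] (u : σ) (d : ℕ) (l : List σ) :
    ∃ c : K, iterPDeriv l ((X u : MvPolynomial σ K) ^ d) = c • (X u : MvPolynomial σ K) ^ (d - l.length) := by
  induction l with
  | nil => exact ⟨1, by simp⟩
  | cons v l ih =>
    obtain ⟨c, hc⟩ := ih
    rw [iterPDeriv_cons, hc, Derivation.map_smul, List.length_cons, X_pow_eq_monomial, pderiv_monomial,
      one_mul, Finsupp.single_apply, X_pow_eq_monomial]
    by_cases huv : u = v
    · subst huv
      refine ⟨c * ((d - l.length : ℕ) : K), ?_⟩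
      rw [if_pos rfl, ← Finsupp.single_tsub, show d - l.length - 1 = d - (l.length + 1) by omega]
      simp only [mul_smul, smul_monomial, smul_eq_mul, mul_one]
    · refine ⟨0, ?_⟩
      rw [if_neg huv, Nat.cast_zero, monomial_zero, smul_zero, zero_smul]

/-- The order-`s` derivatives of a sum of `d`-th powers of variables lie in the span of the
complementary powers ("The space of partial derivatives of order `s` is `⟨y_1^{m-s}, …, y_{m²}^{m-s}⟩`").
[cite: GesmundoLandsberg2017, §4 (Case 3)] -/
theorem span_derivSet_powerSum_le [DecidableEq σ] {α : Type*} (S : Finset α) (f : α → σ) (d s : ℕ) :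
    Submodule.span K (derivSet s (∑ i ∈ S, (X (f i) : MvPolynomial σ K) ^ d)) ≤
      Submodule.span K ((fun i => (X (f i) : MvPolynomial σ K) ^ (d - s)) '' (↑S : Set α)) := by
  classical
  rw [Submodule.span_le]
  rintro _ ⟨l, hl, rfl⟩
  rw [iterPDeriv_sum]
  refine Submodule.sum_mem _ fun i hi => ?_
  obtain ⟨c, hc⟩ := exists_iterPDeriv_X_pow (K := K) (f i) d l
  rw [hc, hl]
  exact Submodule.smul_mem _ _ (Submodule.subset_span ⟨i, Finset.mem_coe.2 hi, rfl⟩)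

variable [Fintype σ] [DecidableEq σ]

/-- **The power sum has few shifted partials**: `rank((Σ_{i∈S} y_i^d)_{(s,·)[τ]}) ≤ #S · binom(#σ+τ-1, τ)`
(its order-`s` derivatives span at most `#S` dimensions; then the no-syzygy bound).
[cite: GesmundoLandsberg2017, §4 (Case 3)] -/
theorem shiftedPartialsRank_powerSum_le {α : Type*} (S : Finset α) (f : α → σ) (d s τ : ℕ) :
    shiftedPartialsRank K s τ (∑ i ∈ S, (X (f i) : MvPolynomial σ K) ^ d) ≤
      S.card * (Fintype.card σ + τ - 1).choose τ := by
  classical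
  refine (shiftedPartialsRank_le_mul_choose s τ _).trans (Nat.mul_le_mul_right _ ?_)
  rw [shiftedPartialsRank_zero_eq]
  set T : Finset (MvPolynomial σ K) := S.image fun i => (X (f i) : MvPolynomial σ K) ^ (d - s) with hT
  have hTS : (↑T : Set (MvPolynomial σ K)) = (fun i => (X (f i) : MvPolynomial σ K) ^ (d - s)) '' (↑S : Set α) := by
    rw [hT, Finset.coe_image]
  haveI : Module.Finite K (Submodule.span K (↑T : Set (MvPolynomial σ K))) :=
    Module.Finite.span_of_finite K T.finite_toSet
  calc Module.finrank K (Submodule.span K (derivSet s (∑ i ∈ S, (X (f i) : MvPolynomial σ K) ^ d)))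
      ≤ Module.finrank K (Submodule.span K (↑T : Set (MvPolynomial σ K))) := by
        refine Submodule.finrank_mono ?_
        rw [hTS]
        exact span_derivSet_powerSum_le S f d s
    _ ≤ T.card := finrank_span_finset_le_card T
    _ ≤ S.card := Finset.card_image_le

end PowerSum

/-! ### Lower bound: outside monomials multiply independently -/

section Outside

variable {K : Type*} [Field K] {σ : Type*}

/-- Injective renamings do not DEcrease flattening ranks either (with `shiftedPartialsRank_zero_rename_le`:
they preserve them). [folklore] -/
theorem le_shiftedPartialsRank_zero_rename [Fintype σ] [DecidableEq σ] {α : Type*} {ι : α → σ}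
    (hι : Function.Injective ι) (s : ℕ) (p : MvPolynomial α K) :
    shiftedPartialsRank K s 0 p ≤ shiftedPartialsRank K s 0 (rename ι p) := by
  classical
  haveI : Module.Finite K (Submodule.span K (derivSet s (rename ι p))) := by
    rw [← shiftedPartials_zero_right]; exact finite_span_shiftedPartials s 0 _
  have hle : (Submodule.span K (derivSet s p)).map (rename ι).toLinearMap ≤
      Submodule.span K (derivSet s (rename ι p)) := by
    rw [Submodule.map_span_le]
    rintro _ ⟨l, hl, rfl⟩
    refine Submodule.subset_span ⟨l.map ι, by simp [hl], ?_⟩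
    rw [AlgHom.toLinearMap_apply, iterPDeriv_rename hι]
  have hinj : Function.Injective (rename ι : MvPolynomial α K →ₐ[K] MvPolynomial σ K).toLinearMap :=
    rename_injective ι hι
  rw [shiftedPartialsRank_zero_eq, shiftedPartialsRank_zero_eq,
    (Submodule.equivMapOfInjective _ hinj (Submodule.span K (derivSet s p))).finrank_eq]
  exact Submodule.finrank_mono hle

variable [DecidableEq σ]

/-- A polynomial in the variables `Z` is supported on monomials vanishing outside `Z`, and so are its
derivatives and their span. [folklore] -/
theorem apply_eq_zero_of_mem_span_derivSet {Z : Finset σ} {p : MvPolynomial σ K} (hZ : p.vars ⊆ Z)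
    {s : ℕ} {g : MvPolynomial σ K} (hg : g ∈ Submodule.span K (derivSet s p))
    {ν : σ →₀ ℕ} (hν : ν ∈ g.support) {o : σ} (ho : o ∉ Z) : ν o = 0 := by
  classical
  have hle : Submodule.span K (derivSet s p) ≤ restrictSupport K {ν : σ →₀ ℕ | ∀ o, o ∉ Z → ν o = 0} := by
    rw [Submodule.span_le]
    rintro _ ⟨l, -, rfl⟩
    rw [SetLike.mem_coe, mem_restrictSupport_iff]
    intro ν hν o ho
    by_contra h
    have : o ∈ (iterPDeriv l p).vars :=
      (mem_vars_iff_mem_support o).2 ⟨ν, Finset.mem_coe.1 hν, Finsupp.mem_support_iff.2 h⟩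
    exact ho (hZ (vars_iterPDeriv_subset l p this))
  exact ((mem_restrictSupport_iff K).1 (hle hg)) (Finset.mem_coe.2 hν) o ho

variable [Fintype σ]

/-- **Outside monomials multiply independently**: for a polynomial `p` in the variables `Z`, the map
`(d_γ)_γ ↦ Σ_γ x^γ d_γ` from families of order-`s` derivative combinations indexed by the monomials
`x^γ` of degree `τ` in the variables outside `Z` is injective into the shifted partials, so
`#Mon_τ(Zᶜ) · rank(p_{s,·}) ≤ rank(p_{(s,·)[τ]})`. (The honest form of "the remaining variables
contribute growth": they contribute AT LEAST this much at shift `0` of the inner polynomial.)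
[cite: GesmundoLandsberg2017, §4 (Cases 1 and 3)] -/
theorem card_mul_shiftedPartialsRank_zero_le {Z : Finset σ} {p : MvPolynomial σ K} (hZ : p.vars ⊆ Z)
    (s τ : ℕ) :
    (Zᶜ.finsuppAntidiag τ).card * shiftedPartialsRank K s 0 p ≤ shiftedPartialsRank K s τ p := by
  classical
  set D := Submodule.span K (derivSet s p) with hD
  set I := ↥(Zᶜ.finsuppAntidiag τ) with hI
  haveI : Module.Finite K D := by
    rw [hD, ← shiftedPartials_zero_right]; exact finite_span_shiftedPartials s 0 p
  haveI := finite_span_shiftedPartials (K := K) s τ p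
  -- the gluing map
  let Ψ : (I → D) →ₗ[K] MvPolynomial σ K :=
    ∑ γ : I, LinearMap.mulLeft K (monomial (γ.1 : σ →₀ ℕ) (1 : K)) ∘ₗ D.subtype ∘ₗ LinearMap.proj γ
  have hΨ : ∀ dγ : I → D, Ψ dγ = ∑ γ : I, monomial (γ.1 : σ →₀ ℕ) (1 : K) * (dγ γ : MvPolynomial σ K) := by
    intro dγ
    simp only [Ψ, LinearMap.coe_sum, Finset.sum_apply, LinearMap.comp_apply, LinearMap.proj_apply,
      Submodule.subtype_apply, LinearMap.mulLeft_apply]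
  -- its range lies in the shifted partials
  have hrange : LinearMap.range Ψ ≤ Submodule.span K (shiftedPartials s τ p) := by
    rintro _ ⟨dγ, rfl⟩
    rw [hΨ]
    refine Submodule.sum_mem _ fun γ _ => ?_
    have hγ := γ.2
    rw [Finset.mem_finsuppAntidiag] at hγ
    refine monomial_mul_mem_span_shiftedPartials (dγ γ).2 ?_
    rw [Finsupp.degree_apply]
    exact (Finset.sum_subset hγ.2 fun u _ hu => Finsupp.notMem_support_iff.1 hu).trans hγ.1
  -- coefficient extraction: `coeff (γ₀ + ν₀) (Ψ d) = coeff ν₀ (d γ₀)` for `ν₀` vanishing outside `Z`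
  have hcoeff : ∀ (dγ : I → D) (γ₀ : I) (ν₀ : σ →₀ ℕ), (∀ o, o ∉ Z → ν₀ o = 0) →
      coeff ((γ₀.1 : σ →₀ ℕ) + ν₀) (Ψ dγ) = coeff ν₀ (dγ γ₀ : MvPolynomial σ K) := by
    intro dγ γ₀ ν₀ hν₀
    rw [hΨ, coeff_sum, Finset.sum_eq_single γ₀]
    · rw [coeff_monomial_mul', if_pos le_self_add, one_mul, add_tsub_cancel_left]
    · intro γ _ hne
      rw [coeff_monomial_mul']
      split_ifs with hle
      · exfalso
        apply hne
        apply Subtype.ext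
        have hγ := γ.2
        have hγ₀ := γ₀.2
        rw [Finset.mem_finsuppAntidiag] at hγ hγ₀
        -- `γ ≤ γ₀` outside `Z`, both vanish on `Z`, equal degrees
        have hle' : (γ.1 : σ →₀ ℕ) ≤ γ₀.1 := by
          intro u
          by_cases hu : u ∈ Z
          · have : (γ.1 : σ →₀ ℕ) u = 0 := Finsupp.notMem_support_iff.1 fun h =>
              (Finset.mem_compl.1 (hγ.2 h)) hu
            rw [this]; exact Nat.zero_le _
          · have := hle u
            rw [Finsupp.add_apply, hν₀ u hu, add_zero] at this
            exact this
        have hdeg : (γ.1 : σ →₀ ℕ).degree = (γ₀.1 : σ →₀ ℕ).degree := by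
          rw [Finsupp.degree_apply, Finsupp.degree_apply,
            Finset.sum_subset hγ.2 fun u _ hu => Finsupp.notMem_support_iff.1 hu,
            Finset.sum_subset hγ₀.2 fun u _ hu => Finsupp.notMem_support_iff.1 hu, hγ.1, hγ₀.1]
        -- `γ₀ = γ + (γ₀ - γ)` with the difference of degree `0`
        have h1 : (γ.1 : σ →₀ ℕ) + (γ₀.1 - γ.1) = γ₀.1 := add_tsub_cancel_of_le hle'
        have h2 := congrArg Finsupp.degree h1
        rw [map_add, hdeg] at h2
        have h3 : ((γ₀.1 : σ →₀ ℕ) - γ.1).degree = 0 := by omega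
        rw [Finsupp.degree_eq_zero_iff] at h3
        rw [h3, add_zero] at h1
        exact h1
      · rfl
    · intro h; exact (h (Finset.mem_univ _)).elim
  -- injectivity
  have hinj : Function.Injective Ψ := by
    rw [← LinearMap.ker_eq_bot, LinearMap.ker_eq_bot']
    intro dγ h0
    funext γ₀
    apply Subtype.ext
    change (dγ γ₀ : MvPolynomial σ K) = 0
    ext ν
    rw [coeff_zero]
    by_cases hν : ∀ o, o ∉ Z → ν o = 0
    · rw [← hcoeff dγ γ₀ ν hν, h0, coeff_zero]
    · push Not at hν
      obtain ⟨o, ho, hνo⟩ := hν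
      by_contra hc
      exact hνo (apply_eq_zero_of_mem_span_derivSet hZ (dγ γ₀).2 (mem_support_iff.2 hc) ho)
  -- dimensions
  calc (Zᶜ.finsuppAntidiag τ).card * shiftedPartialsRank K s 0 p
      = Module.finrank K (I → D) := by
        rw [Module.finrank_pi_fintype, Finset.sum_const, smul_eq_mul, shiftedPartialsRank_zero_eq, ← hD,
          Finset.card_univ, Fintype.card_coe]
    _ = Module.finrank K (LinearMap.range Ψ) := (LinearMap.finrank_range_of_inj hinj).symm
    _ ≤ shiftedPartialsRank K s τ p := Submodule.finrank_mono hrange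

/-- **The permanent side is at least `binom(m,s)² · binom(N-m²+τ-1, τ)`**: its `binom(m,s)²`
order-`s` derivative directions (tree: `flatteningRank_perPoly`) times the monomials of degree `τ` in
the `N - m²` variables outside the permanent's. [cite: GesmundoLandsberg2017, §4 (Case 2: "The space `⟨∂^{=s} perm_m⟩_0` has dimension `binom(m,s)²`")] -/
theorem choose_sq_mul_choose_le_shiftedPartialsRank_perm {m n : ℕ}
    (ι : Fin m × Fin m → Fin m × Fin n × Fin n) (hι : Function.Injective ι) (s τ : ℕ) :
    (m.choose s) ^ 2 * ((Fintype.card (Fin m × Fin n × Fin n) - m * m) + τ - 1).choose τ ≤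
      shiftedPartialsRank K s τ (rename ι (perPoly (Fin m) K)) := by
  classical
  set Z : Finset (Fin m × Fin n × Fin n) := Finset.univ.image ι with hZ
  have hvars : (rename ι (perPoly (Fin m) K)).vars ⊆ Z := by
    intro u hu
    have := vars_rename ι _ hu
    rw [Finset.mem_image] at this
    obtain ⟨q, -, hq⟩ := this
    exact Finset.mem_image.2 ⟨q, Finset.mem_univ _, hq⟩
  have hZcard : Zᶜ.card = Fintype.card (Fin m × Fin n × Fin n) - m * m := by
    rw [Finset.card_compl, hZ, Finset.card_image_of_injective _ hι, Finset.card_univ]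
    simp only [Fintype.card_prod, Fintype.card_fin]
  calc (m.choose s) ^ 2 * ((Fintype.card (Fin m × Fin n × Fin n) - m * m) + τ - 1).choose τ
      = (Zᶜ.finsuppAntidiag τ).card * (m.choose s) ^ 2 := by
        rw [Finset.card_finsuppAntidiag_nat_eq_choose, hZcard, mul_comm]
    _ ≤ (Zᶜ.finsuppAntidiag τ).card * shiftedPartialsRank K s 0 (rename ι (perPoly (Fin m) K)) := by
        refine Nat.mul_le_mul_left _ ?_
        rw [← flatteningRank_perPoly K m s]
        exact le_shiftedPartialsRank_zero_rename hι s _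
    _ ≤ _ := card_mul_shiftedPartialsRank_zero_le hvars s τ

end Outside

/-! ### The comparison -/

section Comparison

variable (K : Type) [Field K]

/-- **The printed Case 3 cannot be completed through its degeneration**: whenever
`m² · binom(N+τ-1, τ) < binom(m,s)² · binom(N-m²+τ-1, τ)` (`N = mn²`; true for all `2 ≤ s ≤ m-2` and
`τ < (N-m²) ln(binom(m,s)²/m²)/m²`, in particular for `m ≥ 5`, `n > m⁵` throughout `m³ < τ ≤ N/m²`),
the power sum `P = Σ_{i∈S} (x⁽⁰⁾ᵢᵢ)^m` on `#S = m²` diagonal variables — the degeneration of `IMM^m_n`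
used in GL §4, Case 3 — has STRICTLY FEWER order-`s` shifted partials of shift `τ` than the permanent,
so `rank P ≥ rank perm_m` (what monotonicity `rank IMM^m_n ≥ rank P` would need) fails.
[cite: GesmundoLandsberg2017, §4 (Case 3)] -/
theorem powerSum_lt_perm_of_lt {m n : ℕ} (S : Finset (Fin n)) (hS : S.card = m * m)
    (ι : Fin m × Fin m → Fin m × Fin n × Fin n) (hι : Function.Injective ι) (t : Fin m) (s τ : ℕ)
    (h : m * m * (Fintype.card (Fin m × Fin n × Fin n) + τ - 1).choose τ <
      (m.choose s) ^ 2 * ((Fintype.card (Fin m × Fin n × Fin n) - m * m) + τ - 1).choose τ) :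
    shiftedPartialsRank K s τ (∑ i ∈ S, X ((t, i, i) : Fin m × Fin n × Fin n) ^ m) <
      shiftedPartialsRank K s τ (rename ι (perPoly (Fin m) K)) := by
  calc shiftedPartialsRank K s τ (∑ i ∈ S, X ((t, i, i) : Fin m × Fin n × Fin n) ^ m)
      ≤ S.card * (Fintype.card (Fin m × Fin n × Fin n) + τ - 1).choose τ :=
        shiftedPartialsRank_powerSum_le S (fun i => ((t, i, i) : Fin m × Fin n × Fin n)) m s τ
    _ = m * m * (Fintype.card (Fin m × Fin n × Fin n) + τ - 1).choose τ := by rw [hS]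
    _ < _ := h
    _ ≤ _ := choose_sq_mul_choose_le_shiftedPartialsRank_perm ι hι s τ

/-- In particular (with `exists_endOrbit_immPoly_eq_powerSum`): under the same numerical condition there
is an element of `End · IMM^m_n` — the printed Case-3 degeneration — whose shifted partials do NOT
dominate the permanent's; the printed sentence "it will suffice to prove the result ... in `m²`
variables" is therefore not a valid reduction at these parameters. [cite: GesmundoLandsberg2017, §4 (Case 3)] -/
theorem exists_case3_degeneration_lt {m n : ℕ} [NeZero m] (hmn : m * m ≤ n)
    (ι : Fin m × Fin m → Fin m × Fin n × Fin n) (hι : Function.Injective ι) (s τ : ℕ)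
    (h : m * m * (Fintype.card (Fin m × Fin n × Fin n) + τ - 1).choose τ <
      (m.choose s) ^ 2 * ((Fintype.card (Fin m × Fin n × Fin n) - m * m) + τ - 1).choose τ) :
    ∃ P ∈ endOrbit (Fin m × Fin n × Fin n) K (immPoly n m K),
      shiftedPartialsRank K s τ P < shiftedPartialsRank K s τ (rename ι (perPoly (Fin m) K)) := by
  classical
  -- `m²` diagonal positions
  obtain ⟨S, -, hS⟩ := Finset.exists_subset_card_eq (s := (Finset.univ : Finset (Fin n)))
    (show m * m ≤ (Finset.univ : Finset (Fin n)).card by simpa using hmn)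
  obtain ⟨P, hP, hPeq⟩ := exists_endOrbit_immPoly_eq_powerSum (K := K) (m := m) (n := n) S
  exact ⟨P, hP, hPeq ▸ powerSum_lt_perm_of_lt K S hS ι hι 0 s τ h⟩

end Comparison

end Literature.Barriers.ValiantsHypothesis
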